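import Literature.NumberTheory.LFunctions.RealZeroNearOneClassNumberCeiling
import Literature.NumberTheory.LFunctions.SiegelZeroClassNumberAllConductors
import HarnessLib

/-!
# Goldfeld–Schinzel's Theorem 1, LOWER half, explicit and in the kernel:
# `(1 − β)(1 + 5(1 − β))·Σ_Q 1/a_Q > (6/π²)·L(1, χ_{−d})` at every real zero `β ∈ [9/10, 1)`

Topic `Literature/NumberTheory/LFunctions` (namespace `Literature.NumberTheory.LFunctions`, sub-namespace
`ClassSumRepulsion`). Everything in this file is PROVED (theorems only; no definition, no named fact, debt 0).
Cell `parity-realchar` (SIEGEL INSTRUMENT), conditionals column topic I.17 «the Siegel zero's distance from 1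
as an asymptotic formula in reduced-form data» — whose entries so far are NAMED FACTS
(`goldfeldSchinzel1975_theorem1`: `1 − β = (6/π²)(L(1,χ)/Σ'1/a)[1 + O((log log|d|)²/log|d|) + O((1−β)log|d|)]`,
`goldfeld1975_theorem1`, `SiegelZeroFormSumAsymptotic.lean`). Here the INEQUALITY `≥` of that formula is
proved with an explicit, `d`-free error factor, from the class-summed Epstein inequality
(`RealZeroRepulsionOddClassSummed.lean`, `RealZeroNearOneClassNumberCeiling.lean`):

* `classSum_lt_of_realZero` (tree): at a real zero `β ∈ [9/10, 1)` of `L(s, χ)` (`χ` odd real primitive mod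
  `d > 4`), `(1/(1−β) + 0.92)·h(−d) < √d(π/6 + 2.6(1−β))·S`, `S = Σ_{Q reduced} 1/a_Q`;
* hence (`one_sub_realZero_mul_sum_gt_classNumber`) **`(1−β)(1 + 5(1−β))·S·(π/6)·√d > h(−d)`**
  (`15.6/π < 5`), i.e. `1 − β > (6/π)·(h(−d)/S)/√d · 1/(1 + 5(1−β))`;
* with the class number formula `L(1, χ) = π h_K/√d = π h(−d)/√d` (tree
  `SiegelZeroClassNumber.lOne_re_eq_of_odd`, `Quadratic.card_reducedForms_eq_classNumber`):
  `goldfeldSchinzel_lower_explicit` — **`(6/π²)·L(1, χ) < (1 − β)(1 + 5(1 − β))·Σ_Q 1/a_Q`**, i.e.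
  **`1 − β > (6/π²)·(L(1,χ)/Σ_Q 1/a_Q)·(1 + 5(1−β))⁻¹`** — Goldfeld–Schinzel's main term EXACTLY, with the
  printed `[1 + O((log log|d|)²/log|d|) + O((1−β) log|d|)]` replaced, on the lower side, by the clean factor
  `(1 + 5(1−β))⁻¹` (no `log|d|` loss: the Epstein constant-term route has exponentially small remainders
  where the Perron/contour route has `(log log d)²/log d`).

Remarks. (i) Goldfeld–Schinzel's `Σ'` runs over the forms `(a, b, c)` of discriminant `−d` with
`−a < b ≤ a < ¼√d`; these are reduced (`c > d/(4a) > a`), so `Σ' ≤ S` and the printed lower bound with `Σ'`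
is (up to its error terms) STRONGER than ours with `S`; the difference `S − Σ'` is the contribution of the
reduced forms with `¼√d ≤ a ≤ √(d/3)`, at most `4h'/√d` for `h'` such forms. (ii) The UPPER half
(`1 − β ≤ (6/π²)(L(1)/Σ')(1 + …)`, i.e. the EXISTENCE side of the asymptotic) needs lower bounds for each
`Re Λ_{z_Q}` (the reverse of `re_lt_of_mem_reducedForms_uniform`), in particular the constant-term identity for the
round classes `√3/2 ≤ Im z_Q < 1`, which the tree does not have — not attempted. (iii) `β ≥ 9/10` is only used
through `10·(1−β)√d ≤ √d`; every Siegel zero of quality `η ≥ 10` at `d ≥ 3` satisfies it.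

LABEL (cell rule): conditionals column I.17, kernel, hypothesis-free; one-sided. WHAT THIS IS NOT: not the
asymptotic EQUALITY; nothing for `d > 0` (Goldfeld–Schinzel's case `d > 0` has `log ε_d`); nothing here bears
on parity (H5).

## References

* [GoldfeldSchinzel1975] D. M. Goldfeld, A. Schinzel, *On Siegel's zero*, Ann. Sc. Norm. Super. Pisa (4) 2 (1975)
  571–583, Theorem 1 (p. 571, (1)–(2)).
* [Goldfeld1975Pisa] D. M. Goldfeld, *An asymptotic formula relating the Siegel zero and the class number of
  quadratic fields*, Ann. Sc. Norm. Super. Pisa (4) 2 (1975) 611–615, Theorem 1 (context).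
* [NeukirchANT1999] Ch. VII §5 (5.11) (class number formula).
-/

noncomputable section

open Complex
open Literature.NumberTheory.QuadraticFields Literature.NumberTheory.QuadraticFields.Quadratic
open Literature.NumberTheory.QuadraticFields.BinaryQuadraticForm (reducedForms mem_reducedForms_iff)

namespace Literature.NumberTheory.LFunctions

namespace ClassSumRepulsion

/-- The sum `Σ_Q 1/a_Q` over reduced forms of a negative discriminant is non-negative. [folklore] -/
private theorem sum_inv_nonneg'' {d : ℕ} (hd : 0 < d) :
    0 ≤ ∑ Q ∈ reducedForms (-(d : ℤ)), (1 : ℝ) / (Q.1 : ℝ) := by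
  refine Finset.sum_nonneg fun Q hQ => ?_
  have hD0 : (-(d : ℤ)) < 0 := by omega
  obtain ⟨-, ha, -, -⟩ := (mem_reducedForms_iff hD0).1 hQ
  have : (0 : ℝ) < Q.1 := by exact_mod_cast ha
  positivity

/-- **`(1 − β)(1 + 5(1 − β))·Σ_Q 1/a_Q·(π/6)·√d > h(−d)`** at every real zero `β ∈ [9/10, 1)` of `L(s, χ)`,
`χ` the odd real primitive character mod `d > 4` — i.e. `1 − β > (6/π)(h(−d)/Σ_Q 1/a_Q)/√d·(1 + 5(1−β))⁻¹`
(from `classSum_lt_of_realZero`, `15.6/π < 5`). [cite: GoldfeldSchinzel1975, Theorem 1 (case d < 0)] -/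
theorem one_sub_realZero_mul_sum_gt_classNumber {d : ℕ} [NeZero d] (hd : 4 < d)
    {χ : DirichletCharacter ℂ d} (hprim : χ.IsPrimitive) (hquad : χ.IsQuadratic) (hodd : χ.Odd)
    {β : ℝ} (hβ9 : 9 / 10 ≤ β) (hβ1 : β < 1) (hz : χ.LFunction β = 0) :
    (BinaryQuadraticForm.classNumber (-(d : ℤ)) : ℝ) <
      (1 - β) * (1 + 5 * (1 - β)) * (∑ Q ∈ reducedForms (-(d : ℤ)), (1 : ℝ) / (Q.1 : ℝ)) *
        (Real.pi / 6) * Real.sqrt d := by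
  have hd4R : (4 : ℝ) < d := by exact_mod_cast hd
  have hsd : 2 ≤ Real.sqrt d := (Real.le_sqrt' two_pos).2 (by linarith)
  have hsd0 : 0 < Real.sqrt d := by linarith
  have hδ0 : 0 < 1 - β := by linarith
  have hπ3 := Real.pi_gt_d2
  have hmain := classSum_lt_of_realZero hd hprim hquad hodd hβ9 hβ1 hz
  set h : ℝ := (BinaryQuadraticForm.classNumber (-(d : ℤ)) : ℝ) with hh
  set S := ∑ Q ∈ reducedForms (-(d : ℤ)), (1 : ℝ) / (Q.1 : ℝ) with hS
  have hh0 : 0 ≤ h := by rw [hh]; positivity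
  have hS0 : 0 ≤ S := sum_inv_nonneg'' (by omega)
  -- `h/(1−β) ≤ (1/(1−β) + 0.92) h < √d(π/6 + 2.6(1−β)) S`
  have h1 : 1 / (1 - β) * h ≤ (1 / (1 - β) + 0.92) * h := by nlinarith
  have h2 : 1 / (1 - β) * h < (Real.sqrt d * (Real.pi / 6) + 2.6 * ((1 - β) * Real.sqrt d)) * S := by
    linarith
  have h3 := mul_lt_mul_of_pos_left h2 hδ0
  have e1 : (1 - β) * (1 / (1 - β) * h) = h := by field_simp
  rw [e1] at h3
  -- `(1−β)·(√dπ/6 + 2.6(1−β)√d)·S = (1−β)(1 + (15.6/π)(1−β))·S·(π/6)√d ≤ (1−β)(1 + 5(1−β))·S·(π/6)√d`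
  have h4 : (1 - β) * ((Real.sqrt d * (Real.pi / 6) + 2.6 * ((1 - β) * Real.sqrt d)) * S) ≤
      (1 - β) * (1 + 5 * (1 - β)) * S * (Real.pi / 6) * Real.sqrt d := by
    have hkey : Real.sqrt d * (Real.pi / 6) + 2.6 * ((1 - β) * Real.sqrt d) ≤
        (1 + 5 * (1 - β)) * (Real.pi / 6) * Real.sqrt d := by
      have h56 : (0 : ℝ) ≤ 5 * (Real.pi / 6) - 2.6 := by linarith
      have hprod : 0 ≤ (1 - β) * Real.sqrt d * (5 * (Real.pi / 6) - 2.6) :=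
        mul_nonneg (mul_nonneg hδ0.le hsd0.le) h56
      nlinarith [hprod]
    have := mul_le_mul_of_nonneg_right hkey hS0
    have := mul_le_mul_of_nonneg_left this hδ0.le
    nlinarith
  linarith

variable {K : Type*} [Field K] [NumberField K]

/-- **Goldfeld–Schinzel's Theorem 1, lower half, explicit (kernel):** for the odd real primitive character `χ`
mod `d > 4` and every real zero `β ∈ [9/10, 1)` of `L(s, χ)`,
`(6/π²)·L(1, χ) < (1 − β)(1 + 5(1 − β))·Σ_{Q reduced of disc −d} 1/a_Q` — Goldfeld–Schinzel's
`1 − β = (6/π²)(L(1,χ)/Σ'1/a)(1 + o(1))` as the one-sided `1 − β > (6/π²)(L(1,χ)/Σ_Q 1/a_Q)/(1 + 5(1−β))`,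
with NO `log|d|` in the error (class number formula `L(1, χ) = π h_K/√d`, `h_K = h(−d)`, for the imaginary
quadratic field of discriminant `−d`). [cite: GoldfeldSchinzel1975, Theorem 1 (case d < 0)]
[cite: NeukirchANT1999, Ch. VII §5 (5.11)] -/
theorem goldfeldSchinzel_lower_explicit {d : ℕ} [NeZero d] (hd : 4 < d)
    {χ : DirichletCharacter ℂ d} (hprim : χ.IsPrimitive) (hquad : χ.IsQuadratic) (hodd : χ.Odd)
    {β : ℝ} (hβ9 : 9 / 10 ≤ β) (hβ1 : β < 1) (hz : χ.LFunction β = 0) :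
    6 / Real.pi ^ 2 * (χ.LFunction 1).re <
      (1 - β) * (1 + 5 * (1 - β)) * ∑ Q ∈ reducedForms (-(d : ℤ)), (1 : ℝ) / (Q.1 : ℝ) := by
  obtain ⟨K, _i1, _i2, h2, hdK⟩ := exists_quadraticField_of_odd_primitive hprim hquad hodd
  have hd4R : (4 : ℝ) < d := by exact_mod_cast hd
  have hsd : 2 ≤ Real.sqrt d := (Real.le_sqrt' two_pos).2 (by linarith)
  have hsd0 : 0 < Real.sqrt d := by linarith
  have hπ0 := Real.pi_pos
  have hmain := one_sub_realZero_mul_sum_gt_classNumber hd hprim hquad hodd hβ9 hβ1 hz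
  have hdneg : NumberField.discr K < 0 := by rw [hdK]; omega
  have hcard := card_reducedForms_eq_classNumber h2 hdneg
  rw [hdK] at hcard
  rw [SiegelZeroClassNumber.lOne_re_eq_of_odd h2 hdK hd hprim hquad hodd, ← hcard]
  set h : ℝ := (BinaryQuadraticForm.classNumber (-(d : ℤ)) : ℝ) with hh
  set S := ∑ Q ∈ reducedForms (-(d : ℤ)), (1 : ℝ) / (Q.1 : ℝ) with hS
  set A := (1 - β) * (1 + 5 * (1 - β)) * S with hA
  -- `h < A (π/6) √d` ⇒ `(6/π²)(π h/√d) = (6/π) h/√d < A`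
  have e : 6 / Real.pi ^ 2 * (Real.pi * h / Real.sqrt d) = (6 / Real.pi) * (h / Real.sqrt d) := by
    field_simp
  rw [e]
  have hlt : h / Real.sqrt d < A * (Real.pi / 6) := by
    rw [div_lt_iff₀ hsd0]; linarith
  calc 6 / Real.pi * (h / Real.sqrt d) < 6 / Real.pi * (A * (Real.pi / 6)) :=
        mul_lt_mul_of_pos_left hlt (by positivity)
    _ = A := by field_simp

/-- **Field-side class-number form**: `h_K < (1 − β)(1 + 5(1−β))·Σ_Q 1/a_Q·(π/6)·√|d_K|` at every real zero
`β ∈ [9/10, 1)` of the Kronecker character's `L`-function, `K` imaginary quadratic with `d_K = −d`.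
[cite: GoldfeldSchinzel1975, Theorem 1 (case d < 0)] [cite: Cox2013, §7.B Thm. 7.7(ii)] -/
theorem classNumber_lt_of_realZero_field (h2 : Module.finrank ℚ K = 2) {d : ℕ} [NeZero d]
    (hdK : NumberField.discr K = -(d : ℤ)) (hd : 4 < d) {χ : DirichletCharacter ℂ d}
    (hprim : χ.IsPrimitive) (hquad : χ.IsQuadratic) (hodd : χ.Odd)
    {β : ℝ} (hβ9 : 9 / 10 ≤ β) (hβ1 : β < 1) (hz : χ.LFunction β = 0) :
    (NumberField.classNumber K : ℝ) <
      (1 - β) * (1 + 5 * (1 - β)) * (∑ Q ∈ reducedForms (-(d : ℤ)), (1 : ℝ) / (Q.1 : ℝ)) *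
        (Real.pi / 6) * Real.sqrt d := by
  have hdneg : NumberField.discr K < 0 := by rw [hdK]; omega
  have hcard := card_reducedForms_eq_classNumber h2 hdneg
  rw [hdK] at hcard
  have := one_sub_realZero_mul_sum_gt_classNumber hd hprim hquad hodd hβ9 hβ1 hz
  rw [hcard] at this
  exact this

end ClassSumRepulsion

end Literature.NumberTheory.LFunctions
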